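import Literature.Computability.Cryptography.RegevSamplerBlock
import Literature.Computability.Cryptography.RegevSamplerLayoutStd
import Literature.Computability.Cryptography.RegevSamplerBlocksStd
import Literature.Computability.Cryptography.RegevSamplerZoneStd
import HarnessLib

/-!
# Regev 2009, Lemma 3.14 in machine form: the per-block bound on the standard layout

Topic `Literature/Computability/Cryptography`, grouping namespace `Regev2009.SamplerRegs`; sequel of
`RegevSamplerBlock.lean`, `RegevSamplerLayoutStd.lean`, `RegevSamplerBlocksStd.lean`, `RegevSamplerZoneStd.lean`.
`exists_negligible_tvDist_machineCirc_le_level` is stated over an abstract layout, block embedding and oracle sub-zone;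
here they are the STANDARD ones (`schedLayout` = `stdLayout` on the register schedule, `stdEmb`, `stdZone`), so that
the only remaining hypotheses are NUMBERS (the register width `W` above four explicit thresholds, the input-zone length
`L ≥ n·max(ℓ, ℓ_Y, ℓ_R)` with the query prefix length `Lq ≤ L`), the query format, and the scalar windows of the block.
The negligible function is named (`νlevel`, by choice from the existential) so that the bound is a plain inequality.

* `νlevel`, `isNegligible_νlevel`; `schedLayout`, `schedLayout_OK`, `schedLayout_fits`, `cOf_schedLayout_eq`; `tvDist_machineCirc_le_std`.

Everything here is proved; no named fact is introduced.

## References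

* O. Regev, *On lattices, learning with errors, random linear codes, and cryptography*, J. ACM 56 (2009),
  art. 34, Lemma 3.14 (statement and proof), Lemma 3.12 (proof) [Regev2009].
-/

noncomputable section

namespace Literature.Computability.Cryptography

namespace Regev2009

namespace SamplerRegs

open Literature.Algebra.EuclideanLattices Literature.Algebra.EuclideanLattices.Regev2009
  Literature.Algebra.EuclideanLattices.Regev2009.QPart Literature.Computability.QuantumComplexity
  Literature.Computability.QuantumComplexity.GaussianCells Literature.Computability.QuantumComplexity.GroverRudolph
  Literature.Computability.QuantumComplexity.GRWord Literature.Computability.QuantumComplexity.QFTQubits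
  Literature.Computability.QuantumComplexity.QFTWord Literature.Computability.QuantumComplexity.TidyBlockFn
  Literature.Computability.QuantumComplexity.QState Literature.Computability.QuantumComplexity.GRMassTable
  Literature.Computability.QuantumComplexity.GRTableMach
  Literature.Computability.Complexity Literature.LinearAlgebra.Matrix.Berkowitz Peikert2009 Finset _root_.Matrix SamplerArith
  SamplerScale SamplerGeom SamplerWords SamplerWordFns SamplerFormats SamplerQuery CVPOracle SamplerClassical
  SamplerClassical.Layout SamplerSubst SamplerDecode _root_.Computability Module
open Literature.Computability.QuantumComplexity.GRCosineMach (pcode abs_cosA_le_one cosA_update)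
open scoped Real

/-! ### The negligible function of the per-block bound, named -/

/-- **The negligible slack of the per-block bound**, chosen once and for all. [cite: Regev2009, Lemma 3.14 (proof)] -/
def νlevel : ℕ → ℝ := Classical.choose exists_negligible_tvDist_machineCirc_le_level

/-- `νlevel` is negligible. [cite: Regev2009, Lemma 3.14 (proof)] -/
theorem isNegligible_νlevel : IsNegligible νlevel := (Classical.choose_spec exists_negligible_tvDist_machineCirc_le_level).1

/-! ### The schedule layout -/

/-- **The schedule layout**: the standard layout with the register schedule `ℓ = schedL`, `ℓ_Y = schedY`, `ℓ_R = schedR`,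
`b_c = schedB`. [cite: Regev2009, Lemma 3.14 (proof)] -/
def schedLayout (n e T m L Lq W : ℕ) (hW : 0 < W) : Layout W n :=
  stdLayout n (schedL n e T m) (schedY n e) (schedR n e T m) (schedB n e T) L Lq W hW

/-- The schedule layout is well formed. [folklore] -/
theorem schedLayout_OK {n e T m L Lq W : ℕ} (hW : 0 < W) (hLq : Lq ≤ L) (hX : n * schedL n e T m ≤ L) (hY : n * schedY n e ≤ L)
    (hS : n * schedR n e T m ≤ L)
    (hWF : stdBase n (schedL n e T m) (schedY n e) (schedR n e T m) (schedB n e T) L + n * QFTKit.qbsize (schedR n e T m) (2 * m + 4) ≤ W) :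
    (schedLayout n e T m L Lq W hW).OK :=
  stdLayout_OK n _ _ _ _ L Lq hW hLq hX hY hS (le_trans (Nat.le_add_right _ _) hWF)

/-- The blocks fit the schedule layout. [folklore] -/
theorem schedLayout_fits {n e T m L Lq W : ℕ} (hW : 0 < W)
    (hWY : topY n (schedL n e T m) (schedY n e) (schedR n e T m) (schedB n e T) L Lq ≤ W)
    (hWS : topS n (schedL n e T m) (schedY n e) (schedR n e T m) (schedB n e T) L Lq ≤ W)
    (hWX : topX n (schedL n e T m) (schedY n e) (schedR n e T m) (schedB n e T) L Lq ≤ W) :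
    Fits (schedLayout n e T m L Lq W hW) :=
  stdLayout_fits n _ _ _ _ L Lq hW hWY hWS hWX

/-- The point wires of the Grover–Rudolph block sit on the first `ℓ` block wires. [folklore] -/
theorem ws_val (ℓ np wl kk : ℕ) (j : Fin ℓ) : (GRData.ws ℓ np wl kk j : ℕ) = j := by
  unfold GRData.ws; exact GRData.dw_val ℓ np wl kk _

/-- The query data of a box point depend on the schedule layout only through the schedule (`ℓ, ℓ_R, b_c`), not through the
zone lengths `L, Lq` or the width `W` — so the data law `w` of A_q14 clause 2 can be chosen before the batch. [folklore] -/
theorem cOf_schedLayout_eq (I : LatticeInstance) (e T m L Lq W L' Lq' W' : ℕ) (hW : 0 < W) (hW' : 0 < W') (t : ℝ) :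
    cOf I (schedLayout I.n e T m L Lq W hW) t = cOf I (schedLayout I.n e T m L' Lq' W' hW') t := rfl

/-! ### The per-block bound on the standard objects -/

section Std

variable (I : LatticeInstance) [IsZLattice ℝ I.lattice] [NeZero I.n] (e T m L Lq W : ℕ) (hW : 0 < W)

local notation "ΛS" => schedLayout (LatticeInstance.n I) e T m L Lq W hW

open Classical in
/-- **Regev 2009, Lemma 3.14 — the per-block bound of the machine on the standard layout, embedding and sub-zone.**
For a nonsingular instance `B` (`n ≥ 5`), precision `m ≥ schedL n e T 0 + 13` (`e ≥ |code B|, n, 2`), an input zone of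
length `L ≥ n·ℓ, n·ℓ_Y, n·ℓ_R` with query prefix `Lq ≤ L`, a register width `W` above the three block tops, the Fourier room,
the Grover–Rudolph blocks and the oracle's wires, positive rationals `aq, ρ` with `2^{-T} ≤ √2ρ√n/aq ≤ 2^T` and the promise
`aq/(√2ρ) < λ₁(L(B)*)/2`, and the budget `U ≥ 6(p+ℓ+3)`: the output law of the machine circuit on the schedule layout is
within `8·√(weightedFail R B r k y (aq/(√2ρ)) w) + νlevel(n)` of `intCoords_* D_{L(B), ρ√n/aq}`.
[cite: Regev2009, Lemma 3.14 (statement and proof), Lemma 3.12 (proof)] -/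
theorem tvDist_machineCirc_le_std (hI : I.IsNonsingular) (he : I.encode.length ≤ e) (hne : I.n ≤ e) (he2 : 2 ≤ e)
    (hn5 : 5 ≤ I.n) (hm : schedL I.n e T 0 + 13 ≤ m)
    (hLq : Lq ≤ L) (hX : I.n * schedL I.n e T m ≤ L) (hY : I.n * schedY I.n e ≤ L) (hS : I.n * schedR I.n e T m ≤ L)
    (hWY : topY I.n (schedL I.n e T m) (schedY I.n e) (schedR I.n e T m) (schedB I.n e T) L Lq ≤ W)
    (hWS : topS I.n (schedL I.n e T m) (schedY I.n e) (schedR I.n e T m) (schedB I.n e T) L Lq ≤ W)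
    (hWX : topX I.n (schedL I.n e T m) (schedY I.n e) (schedR I.n e T m) (schedB I.n e T) L Lq ≤ W)
    (hWF : stdBase I.n (schedL I.n e T m) (schedY I.n e) (schedR I.n e T m) (schedB I.n e T) L +
      I.n * QFTKit.qbsize (schedR I.n e T m) (2 * m + 4) ≤ W)
    (aq ρ : ℚ) (haq : 0 < aq) (hρ : 0 < ρ)
    (htT : tW (aq : ℝ) (ρ : ℝ) I.n ≤ (2 : ℝ) ^ T) (hTt : (2⁻¹ : ℝ) ^ T ≤ tW (aq : ℝ) (ρ : ℝ) I.n)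
    (hprom : (aq : ℝ) / (Real.sqrt 2 * ρ) < minNorm (dualLattice I.lattice) / 2)
    (r : ℚ) (k : ℕ) (y : List Bool) (e' : ℚ) (Fq pad : List Bool)
    (hFq0 : Fq = boolPair (boolPair (stageInput (GapSVPInstance.encode (I, r)) (k + 1) y)
      (boolPair (encodeNat (schedR I.n e T m)) (encodeNat (schedB I.n e T)))) [])
    (hFq : Fq.length = Lq) (huz : (zoneOf Fq ((parOf I, 2 ^ schedR I.n e T m), e') pad).length = L)
    (Rf : UniformQCircuitFamily)
    (hWZ : stdBase I.n (schedL I.n e T m) (schedY I.n e) (schedR I.n e T m) (schedB I.n e T) L +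
      ((ΛS).kq + Rf.family.ancillas (ΛS).kq) ≤ W)
    (U np : ℕ)
    (hnp : (pcode ((Spar (2 ^ schedR I.n e T m) (detA I) aq ρ I.n, (4 * (2 * m + schedL I.n e T m + 3), U)),
      (2 * m + 1, schedL I.n e T m))).length ≤ np)
    (hWE : stdBase I.n (schedL I.n e T m) (schedY I.n e) (schedR I.n e T m) (schedB I.n e T) L +
      I.n * GRData.B (schedL I.n e T m) np (wlen LevelCode.clamp (schedL I.n e T m) np) (2 * m + 1 + 1) ≤ W)
    (x' : EuclideanSpace ℝ (Fin I.n)) (hU : 6 * (4 * (2 * m + schedL I.n e T m + 3) + schedL I.n e T m + 3) ≤ U) :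
    ((bornPMF ((machineCirc I (schedLayout_OK hW hLq hX hY hS hWF) (schedLayout_fits hW hWY hWS hWX) Rf
              (stdZone ΛS (schedLayout_OK hW hLq hX hY hS hWF) hWZ)
              (GRTableMach.data LevelCode.clamp (Spar (2 ^ schedR I.n e T m) (detA I) aq ρ I.n)
                (4 * (2 * m + schedL I.n e T m + 3)) U (2 * m + 1) (schedL I.n e T m) np hnp)
              (stdEmb I (schedLayout_OK hW hLq hX hY hS hWF) hWE)
              (GRData.eraseList (mach LevelCode.clamp (Spar (2 ^ schedR I.n e T m) (detA I) aq ρ I.n)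
                (4 * (2 * m + schedL I.n e T m + 3)) U (2 * m + 1) (schedL I.n e T m) np hnp)
                (stdEmb I (schedLayout_OK hW hLq hX hY hS hWF) hWE))
              (2 * m + 4) (by omega) hWF).runOn 0
          (basisState (boxLab (stdEmb I (schedLayout_OK hW hLq hX hY hS hWF) hWE)
              (GRData.ws (schedL I.n e T m) np (wlen LevelCode.clamp (schedL I.n e T m) np) (2 * m + 1 + 1))
            (GRData.init (mach LevelCode.clamp (Spar (2 ^ schedR I.n e T m) (detA I) aq ρ I.n)
              (4 * (2 * m + schedL I.n e T m + 3)) U (2 * m + 1) (schedL I.n e T m) np hnp))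
            (lab₀ I ΛS (2 ^ schedR I.n e T m) (tW (aq : ℝ) (ρ : ℝ) I.n) (zoneOf Fq ((parOf I, 2 ^ schedR I.n e T m), e') pad) x')
            fun _ => GRData.init (mach LevelCode.clamp (Spar (2 ^ schedR I.n e T m) (detA I) aq ρ I.n)
              (4 * (2 * m + schedL I.n e T m + 3)) U (2 * m + 1) (schedL I.n e T m) np hnp) ∘
              GRData.ws (schedL I.n e T m) np (wlen LevelCode.clamp (schedL I.n e T m) np) (2 * m + 1 + 1))))).map
        fun z => decZ I (2 ^ schedR I.n e T m) (readS (Sblk I (schedLayout_OK (n := I.n) (e := e) (T := T) (m := m) hW hLq hX hY hS hWF)) z)).tvDist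
      ((discreteGaussian I.lattice ((ρ : ℝ) * Real.sqrt I.n / aq) 0).map I.intCoords) ≤
      8 * Real.sqrt (weightedFail Rf I r k y ((aq : ℝ) / (Real.sqrt 2 * ρ))
              (dataLaw (boxSet I.n (schedL I.n e T m) (DT I (2 ^ schedR I.n e T m) (tW (aq : ℝ) (ρ : ℝ) I.n)))
                (fun x => (gaussianFunction 1 x / zBox (boxSet I.n (schedL I.n e T m) (DT I (2 ^ schedR I.n e T m) (tW (aq : ℝ) (ρ : ℝ) I.n)))) ^ 2)
                (fun _ _ => sq_nonneg _)
                (sum_boxWeight_eq_one (boxSet_nonempty I.n (schedL I.n e T m) (DT I (2 ^ schedR I.n e T m) (tW (aq : ℝ) (ρ : ℝ) I.n))))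
                (cOf I ΛS (tW (aq : ℝ) (ρ : ℝ) I.n)))).toReal + νlevel I.n := by
  obtain ⟨-, h⟩ := Classical.choose_spec exists_negligible_tvDist_machineCirc_le_level
  exact h I (Λ := ΛS) (schedLayout_OK hW hLq hX hY hS hWF) (schedLayout_fits hW hWY hWS hWX) hI he hne he2 hn5 hm
    rfl rfl rfl rfl aq ρ haq hρ htT hTt hprom r k y e' Fq pad hFq0 hFq huz Rf
    (stdZone ΛS (schedLayout_OK hW hLq hX hY hS hWF) hWZ) (base_le_stdZone_dirt ΛS _ hWZ) U np hnp
    (blocksFit_stdEmb I _ _ (fun j => ws_val _ _ _ _ j) hWE) x' hU hWF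

end Std

end SamplerRegs

end Regev2009

end Literature.Computability.Cryptography

end
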